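import Summits.QuantumFields.YangMills.Theorems.IsotropyFromPowerCountingTemperedCurvatureMomentsSepDensity
import Summits.QuantumFields.YangMills.Theorems.IsotropyFromPowerCountingTemperedCurvatureMomentsTruncatedTieLimit
import Summits.QuantumFields.YangMills.Theorems.TemperedCurvatureMoments.Negative.TieLoadBearing

/-!
# `TemperedCurvatureMoments`, line `Sketch`, stub A4 (i): product bumps, the tempered pair weight, bump sampling

Support file (general, model-blind analysis on `X = (ℝ⁴)ⁿ = Fin n → E4`) for the stub
`stub_approximantsTransfer` (A4) of the line `Sketch` of crux `stmt-QuantumFields-17721`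
(`IsotropyFromPowerCountingTemperedCurvatureMomentsApproximantsTransfer.lean`), which transfers
tempered tied lattice approximants between admissible spacing/box data by BUMP SAMPLING the
limit functional.

* Product bumps `b_{a,x}(y) = ∏ᵢ ∏_c ρ(yᵢᶜ/a - xᵢᶜ)` (`ρ = pouBump` of `SchwartzPartition`) at mesh
  `a > 0` and multi-site `x ∈ (ℤ⁴)ⁿ`: values in `[0, 1]`, support in the sup-ball `B̄(a x, 2a)`
  (`norm_sub_le_of_prodBump_ne_zero`), smooth and compactly supported after complexification
  (`contDiff_prodBumpC`, `hasCompactSupport_prodBumpC`), and a partition of unity over boxes,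
  `Σ_{x ∈ boxⁿ_R} ∏ᵢ ∏_c ρ(tᵢᶜ - xᵢᶜ) = 1` when `|tᵢᶜ| ≤ R` (`sum_box_prodBump_eq_one`, telescoping).
* The tempered pair weight `w(y) = C (1 + ‖y‖)^N (1 + Σᵢ Σ_{j ≠ i} ‖yᵢ - yⱼ‖⁻¹)^N`: measurable,
  continuous off the coincidence locus; `w ≤ 4^N w(v)` on `B̄(v, 2a)` for `8a`-separated `v`
  (`weight_factors_le_near`); bounded on bounded separated regions
  (`weight_le_of_bounded_separated`); whence `∫ ‖G‖ w ≤ 4^N w(v) (2a)^{4n} vol B̄(0,1)` for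
  `‖G‖ ≤ 1` vanishing off `B̄(v, 2a)` and `∫ ‖G‖ w ≤ ε · const · vol B̄(0, R+1)` for `ε`-small `G`
  living on a bounded separated region (`Measure.addHaar_closedBall'`).
* Bump sampling: Schwartz functions are Lipschitz (`norm_sub_le_seminorm_mul`, mean value
  inequality), so `Σ_{x ∈ boxⁿ_L} P(a x) b_{a,x} - P` is `2 ‖P‖_{0,1} a`-small pointwise
  (`norm_sum_mul_bump_sub_le`) and lives where `P` almost lives
  (`bound_of_sum_mul_bump_sub_ne_zero`).

References: textbook folklore (partitions of unity, mean value inequality, Haar scaling);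
K. Osterwalder, R. Schrader, Comm. Math. Phys. 42 (1975) §2 (temperedness estimates). [folklore]
-/

noncomputable section

namespace Summit.QuantumFields.YangMills.Theorems.TemperedCurvatureMoments.Sketch

open scoped BigOperators SchwartzMap ContDiff
open MeasureTheory Filter Topology Set
open Literature.MathematicalPhysics.QuantumFieldTheory Literature.MathematicalPhysics.QuantumLattice
open Literature.MathematicalPhysics.AQFT
open Literature.Probability.LatticeModels (box Site mem_box box_mono)
open Summit.QuantumFields.YangMills.Theorems.NPointIsotropy.Negative (E4)

namespace ApproximantsTransfer

/-! ## The product bumps `∏ᵢ ∏_c ρ(yᵢᶜ / a - xᵢᶜ)` on `(ℝ⁴)ⁿ` -/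

/-- The product bump is nonnegative. [folklore] -/
theorem prodBump_nonneg {n : ℕ} (a : ℝ) (x : Fin n → Site 4) (y : Fin n → E4) :
    0 ≤ ∏ i, ∏ c, pouBump (y i c / a - x i c) :=
  Finset.prod_nonneg fun _ _ => Finset.prod_nonneg fun _ _ => pouBump_nonneg _

/-- The product bump is at most `1` (each factor `ρ = σ(· + 1) - σ ∈ [0, 1]`). [folklore] -/
theorem prodBump_le_one {n : ℕ} (a : ℝ) (x : Fin n → Site 4) (y : Fin n → E4) :
    ∏ i, ∏ c, pouBump (y i c / a - x i c) ≤ 1 :=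
  Finset.prod_le_one (fun _ _ => Finset.prod_nonneg fun _ _ => pouBump_nonneg _) fun i _ =>
    Finset.prod_le_one (fun _ _ => pouBump_nonneg _) fun c _ => by
      have h1 := Real.smoothTransition.le_one (y i c / a - x i c + 1)
      have h2 := Real.smoothTransition.nonneg (y i c / a - x i c)
      unfold pouBump
      linarith

/-- **Partition of unity on a box**: `∑_{x ∈ boxⁿ_R} ∏ᵢ ∏_c ρ(tᵢᶜ - xᵢᶜ) = 1` whenever `|tᵢᶜ| ≤ R`
(telescoping `sum_Icc_pouBump` in each of the `4n` coordinates, `pouWindow_eq_one`). [folklore] -/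
theorem sum_box_prodBump_eq_one {n : ℕ} (R : ℕ) (t : Fin n → Fin 4 → ℝ) (ht : ∀ i c, |t i c| ≤ R) :
    ∑ x ∈ Fintype.piFinset (fun _ : Fin n => box 4 R), ∏ i, ∏ c, pouBump (t i c - x i c) = 1 := by
  rw [← Finset.prod_univ_sum (fun _ : Fin n => box 4 R) (fun i (z : Site 4) => ∏ c, pouBump (t i c - z c))]
  refine Finset.prod_eq_one fun i _ => ?_
  have hbox : box 4 R = Fintype.piFinset fun _ : Fin 4 => Finset.Icc (-(R : ℤ)) R := rfl
  rw [hbox, ← Finset.prod_univ_sum (fun _ : Fin 4 => Finset.Icc (-(R : ℤ)) R)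
    (fun c (j : ℤ) => pouBump (t i c - j))]
  refine Finset.prod_eq_one fun c _ => ?_
  rw [sum_Icc_pouBump R (t i c)]
  exact pouWindow_eq_one (ht i c)

/-- **Support of the product bump, coordinatewise**: if `∏ᵢ ∏_c ρ(yᵢᶜ/a - xᵢᶜ) ≠ 0` (`a > 0`) then
`|yᵢᶜ - a xᵢᶜ| ≤ a`. [folklore] -/
theorem abs_sub_le_of_prodBump_ne_zero {n : ℕ} {a : ℝ} (ha : 0 < a) {x : Fin n → Site 4}
    {y : Fin n → E4} (h : ∏ i, ∏ c, pouBump (y i c / a - x i c) ≠ 0) (i : Fin n) (c : Fin 4) :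
    |y i c - a * x i c| ≤ a := by
  have h1 := Finset.prod_ne_zero_iff.1 (Finset.prod_ne_zero_iff.1 h i (Finset.mem_univ i)) c
    (Finset.mem_univ c)
  have h2 := tsupport_pouBump_subset (subset_tsupport _ h1)
  rw [mem_Icc, ← abs_le] at h2
  have h3 : y i c / a - x i c = (y i c - a * x i c) / a := by field_simp
  rwa [h3, abs_div, abs_of_pos ha, div_le_iff₀ ha, one_mul] at h2

/-- **Support of the product bump, sup-norm**: if `∏ᵢ ∏_c ρ(yᵢᶜ/a - xᵢᶜ) ≠ 0` (`a > 0`) then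
`‖yᵢ - a xᵢ‖ ≤ 2a` for every `i` (`√4 = 2`), hence `‖y - a x‖ ≤ 2a`. [folklore] -/
theorem norm_sub_le_of_prodBump_ne_zero {n : ℕ} {a : ℝ} (ha : 0 < a) {x : Fin n → Site 4}
    {y : Fin n → E4} (h : ∏ i, ∏ c, pouBump (y i c / a - x i c) ≠ 0) :
    (∀ i, ‖y i - a • siteToE (x i)‖ ≤ 2 * a) ∧ ‖y - fun i => a • siteToE (x i)‖ ≤ 2 * a := by
  have hsqrt : Real.sqrt (Fintype.card (Fin 4) : ℕ) = 2 := by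
    rw [Fintype.card_fin, Nat.cast_ofNat, show (4 : ℝ) = 2 ^ 2 by norm_num,
      Real.sqrt_sq (by norm_num)]
  have hi : ∀ i, ‖y i - a • siteToE (x i)‖ ≤ 2 * a := by
    intro i
    have hcoord : ∀ c : Fin 4, |(y i - a • siteToE (x i)) c| ≤ a := fun c => by
      rw [PiLp.sub_apply, PiLp.smul_apply, siteToE_apply, smul_eq_mul]
      exact abs_sub_le_of_prodBump_ne_zero ha h i c
    have hnorm := EuclideanSpace.norm_le_sqrt_card_mul (y i - a • siteToE (x i)) ha.le hcoord
    rwa [hsqrt] at hnorm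
  exact ⟨hi, (pi_norm_le_iff_of_nonneg (by positivity)).2 fun i => hi i⟩

/-- The complexified product bump is smooth. [folklore] -/
theorem contDiff_prodBumpC {n : ℕ} (a : ℝ) (x : Fin n → Site 4) :
    ContDiff ℝ ∞ fun y : Fin n → E4 => ((∏ i, ∏ c, pouBump (y i c / a - x i c) : ℝ) : ℂ) := by
  have hic : ∀ (i : Fin n) (c : Fin 4), ContDiff ℝ ∞ fun y : Fin n → E4 => pouBump (y i c / a - x i c) :=
    fun i c => contDiff_pouBump.comp (((((EuclideanSpace.proj c).contDiff.comp
      (contDiff_apply ℝ E4 i))).div_const a).sub contDiff_const)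
  exact contDiff_ofReal_comp ℂ (contDiff_prod (t := Finset.univ)
    (f := fun i (y : Fin n → E4) => ∏ c, pouBump (y i c / a - x i c)) fun i _ =>
      contDiff_prod (t := Finset.univ) (f := fun c (y : Fin n → E4) => pouBump (y i c / a - x i c))
        fun c _ => hic i c)

/-- The support of the complexified product bump lies in the sup-ball `B̄(a x, 2a)`. [folklore] -/
theorem tsupport_prodBumpC_subset {n : ℕ} {a : ℝ} (ha : 0 < a) (x : Fin n → Site 4) :
    tsupport (fun y : Fin n → E4 => ((∏ i, ∏ c, pouBump (y i c / a - x i c) : ℝ) : ℂ)) ⊆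
      Metric.closedBall (fun i => a • siteToE (x i)) (2 * a) := by
  refine closure_minimal (fun y hy => ?_) Metric.isClosed_closedBall
  rw [Function.mem_support, Complex.ofReal_ne_zero] at hy
  rw [Metric.mem_closedBall, dist_eq_norm]
  exact (norm_sub_le_of_prodBump_ne_zero ha hy).2

/-- The complexified product bump has compact support. [folklore] -/
theorem hasCompactSupport_prodBumpC {n : ℕ} {a : ℝ} (ha : 0 < a) (x : Fin n → Site 4) :
    HasCompactSupport fun y : Fin n → E4 => ((∏ i, ∏ c, pouBump (y i c / a - x i c) : ℝ) : ℂ) :=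
  IsCompact.of_isClosed_subset (isCompact_closedBall _ _) (isClosed_tsupport _)
    (tsupport_prodBumpC_subset ha x)

/-! ## The tempered pair weight `w y = C (1 + ‖y‖)^N (1 + Σᵢ Σ_{j≠i} ‖yᵢ - yⱼ‖⁻¹)^N` -/

/-- The tempered pair weight is measurable, continuous off the coincidence locus and nonnegative
(`C > 0`). [folklore] -/
theorem weight_measurable_continuousOn_nonneg (n : ℕ) {C : ℝ} (hC : 0 < C) (N : ℕ) :
    Measurable (fun y : Fin n → E4 => C * (1 + ‖y‖) ^ N *
        (1 + ∑ i, ∑ j ∈ Finset.univ.erase i, ‖y i - y j‖⁻¹) ^ N) ∧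
      ContinuousOn (fun y : Fin n → E4 => C * (1 + ‖y‖) ^ N *
        (1 + ∑ i, ∑ j ∈ Finset.univ.erase i, ‖y i - y j‖⁻¹) ^ N) (coincidenceLocus n E4)ᶜ ∧
      ∀ y : Fin n → E4, 0 ≤ C * (1 + ‖y‖) ^ N *
        (1 + ∑ i, ∑ j ∈ Finset.univ.erase i, ‖y i - y j‖⁻¹) ^ N := by
  -- adapted from `stub_stepZeroOfLattice` (MirrorModularBoostsSoftKernelBoostCovarianceStepZeroOfLattice)
  refine ⟨by fun_prop, ?_, fun y => mul_nonneg (mul_nonneg hC.le (by positivity)) (by positivity)⟩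
  refine (continuousOn_const.mul ((continuousOn_const.add continuous_norm.continuousOn).pow N)).mul
    ((continuousOn_const.add (continuousOn_finsetSum _ fun i _ =>
      continuousOn_finsetSum _ fun j hj => ?_)).pow N)
  have hne : ∀ y ∈ (coincidenceLocus n E4)ᶜ, ‖y i - y j‖ ≠ 0 := fun y hy h =>
    hy ⟨i, j, (Finset.ne_of_mem_erase hj).symm, sub_eq_zero.1 (norm_eq_zero.1 h)⟩
  exact ContinuousOn.inv₀ (by fun_prop) hne

/-- The double sum of inverse pair distances is at most `n² M` when each term is `≤ M` (`M ≥ 0`).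
[folklore] -/
theorem sum_sum_inv_le {n : ℕ} (y : Fin n → E4) {M : ℝ} (hM : 0 ≤ M)
    (h : ∀ i j, i ≠ j → ‖y i - y j‖⁻¹ ≤ M) :
    ∑ i, ∑ j ∈ Finset.univ.erase i, ‖y i - y j‖⁻¹ ≤ (n : ℝ) ^ 2 * M := by
  calc ∑ i, ∑ j ∈ Finset.univ.erase i, ‖y i - y j‖⁻¹
      ≤ ∑ i, ∑ j ∈ Finset.univ.erase i, M := Finset.sum_le_sum fun i _ =>
        Finset.sum_le_sum fun j hj => h i j (Finset.ne_of_mem_erase hj).symm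
    _ ≤ ∑ _i : Fin n, ∑ _j : Fin n, M := Finset.sum_le_sum fun i _ =>
        Finset.sum_le_sum_of_subset_of_nonneg (Finset.erase_subset _ _) fun _ _ _ => hM
    _ = (n : ℝ) ^ 2 * M := by
        simp only [Finset.sum_const, Finset.card_univ, Fintype.card_fin, nsmul_eq_mul]
        ring

/-- **The weight near a separated multi-site.** If `8a ≤ ‖vᵢ - vⱼ‖` for `i ≠ j`, `0 < a`, `2a ≤ 1`
and `‖y - v‖ ≤ 2a`, then `(1 + ‖y‖)^N ≤ (2(1 + ‖v‖))^N` and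
`(1 + ΣΣ ‖yᵢ - yⱼ‖⁻¹)^N ≤ (2 (1 + ΣΣ ‖vᵢ - vⱼ‖⁻¹))^N` (`‖yᵢ - yⱼ‖ ≥ ‖vᵢ - vⱼ‖ - 4a ≥ ‖vᵢ - vⱼ‖/2`).
[folklore] -/
theorem weight_factors_le_near {n : ℕ} {a : ℝ} (ha : 0 < a) (ha1 : 2 * a ≤ 1) {v y : Fin n → E4}
    (hsep : ∀ i j, i ≠ j → 8 * a ≤ ‖v i - v j‖) (hy : ‖y - v‖ ≤ 2 * a) (N : ℕ) :
    (1 + ‖y‖) ^ N ≤ (2 * (1 + ‖v‖)) ^ N ∧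
      (1 + ∑ i, ∑ j ∈ Finset.univ.erase i, ‖y i - y j‖⁻¹) ^ N ≤
        (2 * (1 + ∑ i, ∑ j ∈ Finset.univ.erase i, ‖v i - v j‖⁻¹)) ^ N := by
  have hyi : ∀ i, ‖y i - v i‖ ≤ 2 * a := fun i => (norm_le_pi_norm (y - v) i).trans hy
  refine ⟨pow_le_pow_left₀ (by positivity) ?_ N, pow_le_pow_left₀ (by positivity) ?_ N⟩
  · linarith [norm_le_norm_sub_add y v, norm_nonneg v]
  · have hterm : ∀ i, ∀ j ∈ Finset.univ.erase i, ‖y i - y j‖⁻¹ ≤ 2 * ‖v i - v j‖⁻¹ := by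
      intro i j hj
      have h8 := hsep i j (Finset.ne_of_mem_erase hj).symm
      have hlow : ‖v i - v j‖ / 2 ≤ ‖y i - y j‖ := by
        have h1 := norm_sub_le_norm_sub_add_norm_sub (v i) (y j) (v j)
        have h2 := norm_sub_le_norm_sub_add_norm_sub (v i) (y i) (y j)
        rw [norm_sub_rev (v i) (y i)] at h2
        linarith [hyi i, hyi j]
      calc ‖y i - y j‖⁻¹ ≤ (‖v i - v j‖ / 2)⁻¹ :=
            inv_anti₀ (by linarith [mul_pos (by norm_num : (0 : ℝ) < 8) ha]) hlow
        _ = 2 * ‖v i - v j‖⁻¹ := by rw [inv_div, div_eq_mul_inv, mul_comm]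
    have hsum : ∑ i, ∑ j ∈ Finset.univ.erase i, ‖y i - y j‖⁻¹ ≤
        2 * ∑ i, ∑ j ∈ Finset.univ.erase i, ‖v i - v j‖⁻¹ := by
      rw [Finset.mul_sum]
      refine Finset.sum_le_sum fun i _ => ?_
      rw [Finset.mul_sum]
      exact Finset.sum_le_sum (hterm i)
    have h0 : 0 ≤ ∑ i, ∑ j ∈ Finset.univ.erase i, ‖v i - v j‖⁻¹ := by positivity
    linarith

/-- **The weight on a bounded separated region**: if `‖yᵢ‖ ≤ R + 1` for all `i` (`R ≥ 0`) and
`r/2 ≤ ‖yᵢ - yⱼ‖` for `i ≠ j` (`r > 0`), then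
`C (1 + ‖y‖)^N (1 + ΣΣ ‖yᵢ - yⱼ‖⁻¹)^N ≤ C (2 + R)^N (1 + n² (2/r))^N`. [folklore] -/
theorem weight_le_of_bounded_separated {n : ℕ} {C : ℝ} (hC : 0 < C) (N : ℕ) {R r : ℝ} (hR : 0 ≤ R)
    (hr : 0 < r) {y : Fin n → E4} (hyR : ∀ i, ‖y i‖ ≤ R + 1)
    (hysep : ∀ i j, i ≠ j → r / 2 ≤ ‖y i - y j‖) :
    C * (1 + ‖y‖) ^ N * (1 + ∑ i, ∑ j ∈ Finset.univ.erase i, ‖y i - y j‖⁻¹) ^ N ≤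
      C * (2 + R) ^ N * (1 + (n : ℝ) ^ 2 * (2 / r)) ^ N := by
  have hy : ‖y‖ ≤ R + 1 := (pi_norm_le_iff_of_nonneg (by positivity)).2 hyR
  have hs : ∑ i, ∑ j ∈ Finset.univ.erase i, ‖y i - y j‖⁻¹ ≤ (n : ℝ) ^ 2 * (2 / r) :=
    sum_sum_inv_le y (by positivity) fun i j hij => by
      calc ‖y i - y j‖⁻¹ ≤ (r / 2)⁻¹ := inv_anti₀ (by positivity) (hysep i j hij)
        _ = 2 / r := by rw [inv_div]
  have h1 : (1 + ‖y‖) ^ N ≤ (2 + R) ^ N := pow_le_pow_left₀ (by positivity) (by linarith) N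
  have h2 : (1 + ∑ i, ∑ j ∈ Finset.univ.erase i, ‖y i - y j‖⁻¹) ^ N ≤ (1 + (n : ℝ) ^ 2 * (2 / r)) ^ N :=
    pow_le_pow_left₀ (by positivity) (by linarith) N
  exact mul_le_mul (mul_le_mul_of_nonneg_left h1 hC.le) h2 (by positivity) (by positivity)

/-- **Volume of sup-balls in `(ℝ⁴)ⁿ`**: `vol B̄(v, s) = s^{4n} · vol B̄(0, 1)` (`s ≥ 0`). [folklore] -/
theorem volume_closedBall_toReal {n : ℕ} (v : Fin n → E4) {s : ℝ} (hs : 0 ≤ s) :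
    (volume (Metric.closedBall v s)).toReal =
      s ^ (n * 4) * (volume (Metric.closedBall (0 : Fin n → E4) 1)).toReal := by
  have hdim : Module.finrank ℝ (Fin n → E4) = n * 4 := by
    rw [Module.finrank_pi_fintype, finrank_euclideanSpace_fin]
    simp
  rw [Measure.addHaar_closedBall' volume v hs, hdim, ENNReal.toReal_mul,
    ENNReal.toReal_ofReal (by positivity)]

/-- **Integral of a bounded function on a small ball against the weight.** If `‖G y‖ ≤ 1`, `G`
vanishes off `B̄(v, 2a)` with `v` `8a`-separated, `0 < a`, `2a ≤ 1`, then
`∫ ‖G‖ w ≤ 4^N w(v) (2a)^{4n} vol B̄(0,1)`. [folklore] -/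
theorem integral_norm_mul_weight_le_of_ball {n : ℕ} {C : ℝ} (hC : 0 < C) (N : ℕ) {a : ℝ}
    (ha : 0 < a) (ha1 : 2 * a ≤ 1) {v : Fin n → E4} (hsep : ∀ i j, i ≠ j → 8 * a ≤ ‖v i - v j‖)
    (G : (Fin n → E4) → ℂ) (hG1 : ∀ y, ‖G y‖ ≤ 1)
    (hG0 : ∀ y, G y ≠ 0 → ‖y - v‖ ≤ 2 * a) :
    ∫ y, ‖G y‖ * (C * (1 + ‖y‖) ^ N * (1 + ∑ i, ∑ j ∈ Finset.univ.erase i, ‖y i - y j‖⁻¹) ^ N) ≤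
      (4 : ℝ) ^ N * (C * (1 + ‖v‖) ^ N * (1 + ∑ i, ∑ j ∈ Finset.univ.erase i, ‖v i - v j‖⁻¹) ^ N) *
        ((2 * a) ^ (n * 4) * (volume (Metric.closedBall (0 : Fin n → E4) 1)).toReal) := by
  have hball : ∀ y, y ∉ Metric.closedBall v (2 * a) →
      ‖G y‖ * (C * (1 + ‖y‖) ^ N * (1 + ∑ i, ∑ j ∈ Finset.univ.erase i, ‖y i - y j‖⁻¹) ^ N) = 0 := by
    intro y hy
    have hG : G y = 0 := by
      by_contra h
      exact hy (by rw [Metric.mem_closedBall, dist_eq_norm]; exact hG0 y h)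
    rw [hG, norm_zero, zero_mul]
  rw [← setIntegral_eq_integral_of_forall_compl_eq_zero hball, ← volume_closedBall_toReal v (by positivity),
    ← measureReal_def]
  refine (Real.le_norm_self _).trans (norm_setIntegral_le_of_norm_le_const measure_closedBall_lt_top
    fun y hy => ?_)
  rw [Metric.mem_closedBall, dist_eq_norm] at hy
  obtain ⟨h1, h2⟩ := weight_factors_le_near ha ha1 hsep hy N
  rw [norm_mul, norm_norm, Real.norm_of_nonneg (by positivity)]
  calc ‖G y‖ * (C * (1 + ‖y‖) ^ N * (1 + ∑ i, ∑ j ∈ Finset.univ.erase i, ‖y i - y j‖⁻¹) ^ N)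
      ≤ 1 * (C * (2 * (1 + ‖v‖)) ^ N * (2 * (1 + ∑ i, ∑ j ∈ Finset.univ.erase i, ‖v i - v j‖⁻¹)) ^ N) := by
        refine mul_le_mul (hG1 y) ?_ (by positivity) zero_le_one
        gcongr
    _ = _ := by
        rw [mul_pow, mul_pow, show (4 : ℝ) ^ N = 2 ^ N * 2 ^ N by rw [← mul_pow]; norm_num]
        ring

/-- **Integral of an `ε`-small function on the bounded separated region against the weight.** If
`‖G y‖ ≤ ε` everywhere and `G y ≠ 0` forces `‖yᵢ‖ ≤ R + 1` and `r/2 ≤ ‖yᵢ - yⱼ‖` (`i ≠ j`), then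
`∫ ‖G‖ w ≤ ε · C (2 + R)^N (1 + n² (2/r))^N · vol B̄(0, R + 1)`. [folklore] -/
theorem integral_norm_mul_weight_le_of_separated {n : ℕ} {C : ℝ} (hC : 0 < C) (N : ℕ) {R r ε : ℝ}
    (hR : 0 ≤ R) (hr : 0 < r) (hε : 0 ≤ ε) (G : (Fin n → E4) → ℂ) (hGε : ∀ y, ‖G y‖ ≤ ε)
    (hG0 : ∀ y, G y ≠ 0 → (∀ i, ‖y i‖ ≤ R + 1) ∧ ∀ i j, i ≠ j → r / 2 ≤ ‖y i - y j‖) :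
    ∫ y, ‖G y‖ * (C * (1 + ‖y‖) ^ N * (1 + ∑ i, ∑ j ∈ Finset.univ.erase i, ‖y i - y j‖⁻¹) ^ N) ≤
      ε * (C * (2 + R) ^ N * (1 + (n : ℝ) ^ 2 * (2 / r)) ^ N) *
        (volume (Metric.closedBall (0 : Fin n → E4) (R + 1))).toReal := by
  have hball : ∀ y, y ∉ Metric.closedBall (0 : Fin n → E4) (R + 1) →
      ‖G y‖ * (C * (1 + ‖y‖) ^ N * (1 + ∑ i, ∑ j ∈ Finset.univ.erase i, ‖y i - y j‖⁻¹) ^ N) = 0 := by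
    intro y hy
    have hG : G y = 0 := by
      by_contra h
      exact hy (mem_closedBall_zero_iff.2 ((pi_norm_le_iff_of_nonneg (by positivity)).2 (hG0 y h).1))
    rw [hG, norm_zero, zero_mul]
  rw [← setIntegral_eq_integral_of_forall_compl_eq_zero hball, ← measureReal_def]
  refine (Real.le_norm_self _).trans (norm_setIntegral_le_of_norm_le_const measure_closedBall_lt_top
    fun y _ => ?_)
  rw [norm_mul, norm_norm, Real.norm_of_nonneg (by positivity)]
  by_cases hGy : G y = 0
  · rw [hGy, norm_zero, zero_mul]
    positivity
  · obtain ⟨h1, h2⟩ := hG0 y hGy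
    exact mul_le_mul (hGε y) (weight_le_of_bounded_separated hC N hR hr h1 h2) (by positivity) hε

/-! ## Bump sampling of a Lipschitz test function -/

/-- **Schwartz functions are Lipschitz**: `‖P y - P z‖ ≤ ‖P‖_{0,1} ‖y - z‖` (mean value inequality).
[folklore] -/
theorem norm_sub_le_seminorm_mul {V : Type*} [NormedAddCommGroup V] [NormedSpace ℝ V]
    (P : 𝓢(V, ℂ)) (y z : V) : ‖P y - P z‖ ≤ SchwartzMap.seminorm ℂ 0 1 P * ‖y - z‖ :=
  Convex.norm_image_sub_le_of_norm_fderiv_le (𝕜 := ℝ) (f := ⇑P) (s := univ)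
    (fun _ _ => P.differentiableAt)
    (fun v _ => by
      rw [← norm_iteratedFDeriv_one (𝕜 := ℝ)]
      exact SchwartzMap.norm_iteratedFDeriv_le_seminorm ℂ P 1 v)
    convex_univ (mem_univ z) (mem_univ y)

/-- **Bump-sampling error, pointwise.** For a test function `P` with `P(a x) = 0` unless `x ∈ boxⁿ_L`,
the bump-sampled function `Σ_{x ∈ boxⁿ_L} P(a x) b_{a,x}` differs from `P` by at most `2 ‖P‖_{0,1} a`
pointwise: both are sums over a larger box against the partition of unity `Σ_x b_{a,x}(y) = 1`, and
`b_{a,x}(y) ≠ 0` forces `‖y - a x‖ ≤ 2a` (mean value inequality). [folklore] -/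
theorem norm_sum_mul_bump_sub_le {n : ℕ} {a : ℝ} (ha : 0 < a) (P : 𝓢((Fin n → E4), ℂ)) (L : ℕ)
    (hPB : ∀ x : Fin n → Site 4, P (fun i => a • siteToE (x i)) ≠ 0 →
      x ∈ Fintype.piFinset fun _ : Fin n => box 4 L)
    (y : Fin n → E4) :
    ‖∑ x ∈ Fintype.piFinset (fun _ : Fin n => box 4 L),
        P (fun i => a • siteToE (x i)) * ((∏ i, ∏ c, pouBump (y i c / a - x i c) : ℝ) : ℂ) - P y‖ ≤
      2 * SchwartzMap.seminorm ℂ 0 1 P * a := by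
  set K := SchwartzMap.seminorm ℂ 0 1 P with hK
  set b : (Fin n → Site 4) → ℝ := fun x => ∏ i, ∏ c, pouBump (y i c / a - x i c) with hb
  set R' : ℕ := L + ⌈‖y‖ / a⌉₊ with hR'
  set B' : Finset (Fin n → Site 4) := Fintype.piFinset fun _ : Fin n => box 4 R' with hB'
  have hBB' : Fintype.piFinset (fun _ : Fin n => box 4 L) ⊆ B' :=
    Fintype.piFinset_subset _ _ fun _ => box_mono 4 (Nat.le_add_right L _)
  have hy : ∀ i c, |y i c / a| ≤ R' := by
    intro i c
    rw [abs_div, abs_of_pos ha, div_le_iff₀ ha]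
    have h1 : |y i c| ≤ ‖y‖ := by
      rw [← Real.norm_eq_abs]
      exact (PiLp.norm_apply_le (y i) c).trans (norm_le_pi_norm y i)
    have h2 : ‖y‖ / a ≤ ⌈‖y‖ / a⌉₊ := Nat.le_ceil _
    rw [div_le_iff₀ ha] at h2
    have h3 : (⌈‖y‖ / a⌉₊ : ℝ) ≤ R' := by
      rw [hR', Nat.cast_add]
      linarith [(Nat.cast_nonneg L : (0 : ℝ) ≤ L)]
    nlinarith
  have hone : ∑ x ∈ B', b x = 1 := sum_box_prodBump_eq_one R' (fun i c => y i c / a) hy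
  have h1 : ∑ x ∈ Fintype.piFinset (fun _ : Fin n => box 4 L), P (fun i => a • siteToE (x i)) * (b x : ℂ) =
      ∑ x ∈ B', P (fun i => a • siteToE (x i)) * (b x : ℂ) :=
    Finset.sum_subset hBB' fun x _ hxB => by
      rw [not_not.1 fun h => hxB (hPB x h), zero_mul]
  have h2 : P y = ∑ x ∈ B', P y * (b x : ℂ) := by
    rw [← Finset.mul_sum, ← Complex.ofReal_sum, hone, Complex.ofReal_one, mul_one]
  rw [h1, h2, ← Finset.sum_sub_distrib]
  calc ‖∑ x ∈ B', (P (fun i => a • siteToE (x i)) * (b x : ℂ) - P y * (b x : ℂ))‖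
      ≤ ∑ x ∈ B', ‖P (fun i => a • siteToE (x i)) * (b x : ℂ) - P y * (b x : ℂ)‖ := norm_sum_le _ _
    _ ≤ ∑ x ∈ B', K * (2 * a) * b x := Finset.sum_le_sum fun x _ => by
        have hb0 : 0 ≤ b x := prodBump_nonneg a x y
        rw [← sub_mul, norm_mul, Complex.norm_real, Real.norm_of_nonneg hb0]
        by_cases hbx : b x = 0
        · rw [hbx, mul_zero, mul_zero]
        · refine mul_le_mul_of_nonneg_right ?_ hb0
          have hd := (norm_sub_le_of_prodBump_ne_zero ha hbx).2
          rw [norm_sub_rev] at hd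
          exact (norm_sub_le_seminorm_mul P _ _).trans (mul_le_mul_of_nonneg_left hd (apply_nonneg _ _))
    _ = 2 * K * a := by rw [← Finset.mul_sum, hone]; ring

end ApproximantsTransfer

open ApproximantsTransfer in
/-- **Where the bump-sampling error lives.** If `P z ≠ 0` forces `‖zᵢ‖ ≤ R` and `r ≤ ‖zᵢ - zⱼ‖`
(`i ≠ j`), `0 < a`, `2a ≤ 1` and `8a ≤ r`, then `Σ_{x ∈ B} P(a x) b_{a,x}(y) - P y ≠ 0` forces
`‖yᵢ‖ ≤ R + 1` and `r/2 ≤ ‖yᵢ - yⱼ‖` (`i ≠ j`).  (Helper stub of `stub_approximantsTransfer`,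
registered on the crux item for this support file.) [folklore] -/
theorem bound_of_sum_mul_bump_sub_ne_zero :
    ∀ {n : ℕ} {a r R : ℝ}, 0 < a → 2 * a ≤ 1 → 8 * a ≤ r → ∀ (P : 𝓢((Fin n → E4), ℂ)),
      (∀ z, P z ≠ 0 → (∀ i, ‖z i‖ ≤ R) ∧ ∀ i j, i ≠ j → r ≤ ‖z i - z j‖) →
      ∀ (B : Finset (Fin n → Site 4)) (y : Fin n → E4),
        ∑ x ∈ B, P (fun i => a • siteToE (x i)) * ((∏ i, ∏ c, pouBump (y i c / a - x i c) : ℝ) : ℂ) -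
          P y ≠ 0 →
        (∀ i, ‖y i‖ ≤ R + 1) ∧ ∀ i j, i ≠ j → r / 2 ≤ ‖y i - y j‖ := by
  intro n a r R ha ha1 har P hPsupp B y h
  by_cases hPy : P y = 0
  · rw [hPy, sub_zero] at h
    obtain ⟨x, -, hx⟩ := Finset.exists_ne_zero_of_sum_ne_zero h
    have hPx : P (fun i => a • siteToE (x i)) ≠ 0 := left_ne_zero_of_mul hx
    have hbx : ∏ i, ∏ c, pouBump (y i c / a - x i c) ≠ 0 := by
      have h' := right_ne_zero_of_mul hx
      rwa [Complex.ofReal_ne_zero] at h'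
    obtain ⟨h1, h2⟩ := hPsupp _ hPx
    have hyi := (norm_sub_le_of_prodBump_ne_zero ha hbx).1
    refine ⟨fun i => ?_, fun i j hij => ?_⟩
    · linarith [h1 i, hyi i, norm_le_norm_sub_add (y i) (a • siteToE (x i))]
    · have h3 := norm_sub_le_norm_sub_add_norm_sub (a • siteToE (x i)) (y j) (a • siteToE (x j))
      have h4 := norm_sub_le_norm_sub_add_norm_sub (a • siteToE (x i)) (y i) (y j)
      rw [norm_sub_rev (a • siteToE (x i)) (y i)] at h4
      linarith [h2 i j hij, hyi i, hyi j]
  · obtain ⟨h1, h2⟩ := hPsupp y hPy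
    exact ⟨fun i => by linarith [h1 i], fun i j hij => by linarith [h2 i j hij]⟩

end Summit.QuantumFields.YangMills.Theorems.TemperedCurvatureMoments.Sketch

end
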